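import Mathlib
import HarnessLib
import Summits.HubbardSuperconductivity.HubbardSuperconductivity.Theorems.KLProgrammeThermalGreenHubbardTorusExact

/-!
# The re-amputated Matsubara Green function in an ARBITRARY frame: exact form and a volume-uniform bound for every coupling
# (seat hubbard-kl-k3c5-p2, g2)

Route `KLProgramme`, child 5 (stmt-HubbardSuperconductivity-19826).  The carrier of `FinalTwoLegVolLimit β U μ K Mstar` is the two-point function
re-amputated by the FRAME propagator `ĝ_K = 1/(−ik₀ + e_K)`, `e_K = ε − μ + K(p)` (`…VolumeLimitFrameReduction`: `Σ̂^K = (ĝ_K − G)/ĝ_K²`).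
`…ThermalGreenHubbardTorusExact` treated the bare frame (`κ := K(p) = 0`).  For a general frame value `κ ∈ ℝ` at the momentum in question, with
`D = −ik₀ + ξ`, `D_κ = −ik₀ + ξ + κ`, the two Schwinger–Dyson relations `𝒢·D = 1 − U𝒴`, `𝒴·D = ⟨{T,c†}⟩ − U𝒵` (`matsubara_dyson`) give the EXACT
form

  `(1/D_κ − 𝒢)·D_κ² = −κ·(D_κ/D) + (U⟨{T,c†}⟩ − U²𝒵)·(D_κ/D)²`   (`reamputated_matsubaraGreen_frame_eq`),

and since `‖D_κ/D‖ ≤ 1 + |κ|/|k₀|` the M = ∞ shadow of the framed carrier obeys, for EVERY real `U`, every `L ≥ 3`, momentum and fermionic `k₀`,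

  `‖(1/D_κ − 𝒢)·D_κ²‖ ≤ (1 + |κ|/|k₀|)·(|κ| + (1 + |κ|/|k₀|)·|U|(2 + β|U|))`   (`norm_reamputated_matsubaraGreen_frame_le`),

`≤ (1 + |κ|β/π)(|κ| + (1 + |κ|β/π)|U|(2 + β|U|))` at the tree's frequencies (`|k₀| ≥ π/β`, `…_fermi`).  Everything is proved; no definition.
-/

noncomputable section

namespace Summit.HubbardSuperconductivity.HubbardSuperconductivity.Theorems.ThermalGreen

set_option linter.dupNamespace false -- summit = problem name (single-conjunct summit), D-0017

open scoped Matrix.Norms.L2Operator ComplexConjugate ComplexOrder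
open Matrix Complex MeasureTheory intervalIntegral Literature.MathematicalPhysics.QuantumLattice Literature.Probability.LatticeModels
open HubbardWave0

variable {L : ℕ} [NeZero L]

/-- `‖(−ik₀ + ξ + κ)/(−ik₀ + ξ)‖ ≤ 1 + |κ|/|k₀|` for `k₀ ≠ 0`. -/
theorem norm_frame_ratio_le {k₀ : ℝ} (hk : k₀ ≠ 0) (ξ κ : ℝ) :
    ‖(-I * k₀ + (ξ : ℂ) + (κ : ℂ)) / (-I * k₀ + (ξ : ℂ))‖ ≤ 1 + |κ| / |k₀| := by
  set D : ℂ := -I * k₀ + (ξ : ℂ) with hD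
  have hk0D : |k₀| ≤ ‖D‖ := by
    have h1 : |k₀| = |D.im| := by simp [hD]
    rw [h1]; exact Complex.abs_im_le_norm D
  have hDne : D ≠ 0 := by
    intro h; rw [h, norm_zero] at hk0D; exact absurd hk0D (not_le.mpr (abs_pos.mpr hk))
  rw [show -I * k₀ + (ξ : ℂ) + (κ : ℂ) = D + (κ : ℂ) by rw [hD], add_div, div_self hDne]
  calc ‖(1 : ℂ) + (κ : ℂ) / D‖ ≤ ‖(1 : ℂ)‖ + ‖(κ : ℂ) / D‖ := norm_add_le _ _
    _ = 1 + |κ| / ‖D‖ := by rw [norm_one, norm_div, Complex.norm_real, Real.norm_eq_abs]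
    _ ≤ 1 + |κ| / |k₀| := by gcongr

/-- **EXACT FRAMED FORM.**  With `D = −ik₀ + ξ`, `D_κ = D + κ` (`κ` the frame's value at the momentum), `𝒢`, `𝒵`, `T` as in
`…ThermalGreenHubbardTorusExact`: `(1/D_κ − 𝒢)·D_κ² = −κ·(D_κ/D) + (U⟨Tc† + c†T⟩ − U²𝒵)·(D_κ/D)²`. -/
theorem reamputated_matsubaraGreen_frame_eq (hL : 3 ≤ L) (U μ β κ : ℝ) (k : TorusSite 2 L) {k₀ : ℝ} (hk : cexp (I * k₀ * β) = -1) :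
    (1 / (-I * k₀ + ((torusBand L k - μ : ℝ) : ℂ) + (κ : ℂ)) -
          ∫ τ in (0 : ℝ)..β, cexp (I * k₀ * τ) * gibbsState β (hubbardTorusWith 2 L 1 U μ)
            (imagTimeEvolve (hubbardTorusWith 2 L 1 U μ) (τ : ℂ) (momentumAnnihilation k 0) * momentumCreation k 0)) *
        (-I * k₀ + ((torusBand L k - μ : ℝ) : ℂ) + (κ : ℂ)) ^ 2 =
      -(κ : ℂ) * ((-I * k₀ + ((torusBand L k - μ : ℝ) : ℂ) + (κ : ℂ)) / (-I * k₀ + ((torusBand L k - μ : ℝ) : ℂ))) +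
        ((U : ℂ) * gibbsState β (hubbardTorusWith 2 L 1 U μ)
            ((∑ z : FermionTorus 2 L, (torusFourierWeight 2 L * torusChar k z.toTorusSite) • (numberOp z 1 * creation (orb z 0)))ᴴ *
                momentumCreation k 0 +
              momentumCreation k 0 *
                (∑ z : FermionTorus 2 L, (torusFourierWeight 2 L * torusChar k z.toTorusSite) • (numberOp z 1 * creation (orb z 0)))ᴴ) -
          (U : ℂ) ^ 2 * ∫ τ in (0 : ℝ)..β, cexp (I * k₀ * τ) * gibbsState β (hubbardTorusWith 2 L 1 U μ)
            (imagTimeEvolve (hubbardTorusWith 2 L 1 U μ) (τ : ℂ)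
                (∑ z : FermionTorus 2 L, (torusFourierWeight 2 L * torusChar k z.toTorusSite) • (numberOp z 1 * creation (orb z 0)))ᴴ *
              (∑ z : FermionTorus 2 L, (torusFourierWeight 2 L * torusChar k z.toTorusSite) • (numberOp z 1 * creation (orb z 0)))ᴴᴴ)) *
          ((-I * k₀ + ((torusBand L k - μ : ℝ) : ℂ) + (κ : ℂ)) / (-I * k₀ + ((torusBand L k - μ : ℝ) : ℂ))) ^ 2 := by
  obtain ⟨e1, e2⟩ := matsubara_dyson hL U μ β k hk
  have hkr : k₀ ≠ 0 := ne_zero_of_cexp_eq_neg_one hk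
  set D : ℂ := -I * k₀ + ((torusBand L k - μ : ℝ) : ℂ) with hD
  have hDne : D ≠ 0 := by
    intro h
    have := congrArg Complex.im h
    simp [hD] at this
    exact hkr this
  set Dk : ℂ := D + (κ : ℂ) with hDk
  set G : ℂ := ∫ τ in (0 : ℝ)..β, cexp (I * k₀ * τ) * gibbsState β (hubbardTorusWith 2 L 1 U μ)
    (imagTimeEvolve (hubbardTorusWith 2 L 1 U μ) (τ : ℂ) (momentumAnnihilation k 0) * momentumCreation k 0) with hG
  set Y : ℂ := ∫ τ in (0 : ℝ)..β, cexp (I * k₀ * τ) * gibbsState β (hubbardTorusWith 2 L 1 U μ)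
    (imagTimeEvolve (hubbardTorusWith 2 L 1 U μ) (τ : ℂ)
        (∑ z : FermionTorus 2 L, (torusFourierWeight 2 L * torusChar k z.toTorusSite) • (numberOp z 1 * creation (orb z 0)))ᴴ *
      momentumCreation k 0) with hY
  -- `G = (1 − U Y)/D`, `Y·D = m − U Z`; everything is rational in `D`, `Dk`
  have hG' : G = (1 - (U : ℂ) * Y) / D := by rw [← e1]; field_simp
  by_cases hDk0 : Dk = 0
  · -- degenerate frame value `D_κ = 0`: both sides vanish
    rw [hDk0]; simp
  rw [hG']
  have key : (1 / Dk - (1 - (U : ℂ) * Y) / D) * Dk ^ 2 = -(κ : ℂ) * (Dk / D) + ((U : ℂ) * (Y * D)) * (Dk / D) ^ 2 := by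
    have hκ : (κ : ℂ) = Dk - D := by rw [hDk]; ring
    rw [hκ]
    field_simp
    ring
  rw [key, e2]
  ring

/-- **BOUND IN AN ARBITRARY FRAME, ALL COUPLINGS, UNIFORM IN THE VOLUME.**  For `L ≥ 3`, `0 ≤ β`, every real `U, μ, κ`, every torus momentum and
fermionic `k₀`: `‖(1/D_κ − 𝒢)·D_κ²‖ ≤ (1 + |κ|/|k₀|)·(|κ| + (1 + |κ|/|k₀|)·|U|(2 + β|U|))`. -/
theorem norm_reamputated_matsubaraGreen_frame_le (hL : 3 ≤ L) (U μ κ : ℝ) {β : ℝ} (hβ : 0 ≤ β) (k : TorusSite 2 L) {k₀ : ℝ}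
    (hk : cexp (I * k₀ * β) = -1) :
    ‖(1 / (-I * k₀ + ((torusBand L k - μ : ℝ) : ℂ) + (κ : ℂ)) -
          ∫ τ in (0 : ℝ)..β, cexp (I * k₀ * τ) * gibbsState β (hubbardTorusWith 2 L 1 U μ)
            (imagTimeEvolve (hubbardTorusWith 2 L 1 U μ) (τ : ℂ) (momentumAnnihilation k 0) * momentumCreation k 0)) *
        (-I * k₀ + ((torusBand L k - μ : ℝ) : ℂ) + (κ : ℂ)) ^ 2‖ ≤
      (1 + |κ| / |k₀|) * (|κ| + (1 + |κ| / |k₀|) * (|U| * (2 + β * |U|))) := by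
  have hkr : k₀ ≠ 0 := ne_zero_of_cexp_eq_neg_one hk
  rw [reamputated_matsubaraGreen_frame_eq hL U μ β κ k hk]
  have hr := norm_frame_ratio_le hkr (torusBand L k - μ) κ
  have hcore := norm_reamputated_matsubaraGreen_le_linear hL U μ hβ k hk
  rw [reamputated_matsubaraGreen_eq hL U μ β k hk] at hcore
  set r : ℂ := (-I * k₀ + ((torusBand L k - μ : ℝ) : ℂ) + (κ : ℂ)) / (-I * k₀ + ((torusBand L k - μ : ℝ) : ℂ)) with hrdef
  set X : ℂ := (U : ℂ) * gibbsState β (hubbardTorusWith 2 L 1 U μ)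
      ((∑ z : FermionTorus 2 L, (torusFourierWeight 2 L * torusChar k z.toTorusSite) • (numberOp z 1 * creation (orb z 0)))ᴴ *
          momentumCreation k 0 +
        momentumCreation k 0 *
          (∑ z : FermionTorus 2 L, (torusFourierWeight 2 L * torusChar k z.toTorusSite) • (numberOp z 1 * creation (orb z 0)))ᴴ) -
    (U : ℂ) ^ 2 * ∫ τ in (0 : ℝ)..β, cexp (I * k₀ * τ) * gibbsState β (hubbardTorusWith 2 L 1 U μ)
      (imagTimeEvolve (hubbardTorusWith 2 L 1 U μ) (τ : ℂ)
          (∑ z : FermionTorus 2 L, (torusFourierWeight 2 L * torusChar k z.toTorusSite) • (numberOp z 1 * creation (orb z 0)))ᴴ *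
        (∑ z : FermionTorus 2 L, (torusFourierWeight 2 L * torusChar k z.toTorusSite) • (numberOp z 1 * creation (orb z 0)))ᴴᴴ) with hX
  have hr0 : 0 ≤ 1 + |κ| / |k₀| := by positivity
  calc ‖-(κ : ℂ) * r + X * r ^ 2‖ ≤ ‖-(κ : ℂ) * r‖ + ‖X * r ^ 2‖ := norm_add_le _ _
    _ = |κ| * ‖r‖ + ‖X‖ * ‖r‖ ^ 2 := by rw [norm_mul, norm_neg, Complex.norm_real, Real.norm_eq_abs, norm_mul, norm_pow]
    _ ≤ |κ| * (1 + |κ| / |k₀|) + (|U| * (2 + β * |U|)) * (1 + |κ| / |k₀|) ^ 2 := by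
        gcongr
    _ = (1 + |κ| / |k₀|) * (|κ| + (1 + |κ| / |k₀|) * (|U| * (2 + β * |U|))) := by ring

/-- The same at the tree's fermionic frequencies (`|k₀| ≥ π/β`, `β > 0`):
`‖(1/D_κ − 𝒢)·D_κ²‖ ≤ (1 + |κ|β/π)·(|κ| + (1 + |κ|β/π)·|U|(2 + β|U|))` for all `L ≥ 3`, `k`, `m`. -/
theorem norm_reamputated_matsubaraGreen_frame_le_fermi (hL : 3 ≤ L) (U μ κ : ℝ) {β : ℝ} (hβ : 0 < β) (k : TorusSite 2 L) (m : ℤ) :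
    ‖(1 / (-I * (fermiMatsubara β m : ℝ) + ((torusBand L k - μ : ℝ) : ℂ) + (κ : ℂ)) -
          ∫ τ in (0 : ℝ)..β, cexp (I * (fermiMatsubara β m : ℝ) * τ) * gibbsState β (hubbardTorusWith 2 L 1 U μ)
            (imagTimeEvolve (hubbardTorusWith 2 L 1 U μ) (τ : ℂ) (momentumAnnihilation k 0) * momentumCreation k 0)) *
        (-I * (fermiMatsubara β m : ℝ) + ((torusBand L k - μ : ℝ) : ℂ) + (κ : ℂ)) ^ 2‖ ≤
      (1 + |κ| * β / Real.pi) * (|κ| + (1 + |κ| * β / Real.pi) * (|U| * (2 + β * |U|))) := by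
  have h := norm_reamputated_matsubaraGreen_frame_le hL U μ κ hβ.le k (cexp_fermiMatsubara_mul_beta hβ.ne' m)
  refine h.trans ?_
  have hk₀ : Real.pi / β ≤ |fermiMatsubara β m| := pi_div_le_abs_fermiMatsubara hβ m
  have hπβ : 0 < Real.pi / β := div_pos Real.pi_pos hβ
  have hk₀pos : 0 < |fermiMatsubara β m| := lt_of_lt_of_le hπβ hk₀
  have hinv : |κ| / |fermiMatsubara β m| ≤ |κ| * β / Real.pi := by
    rw [div_le_div_iff₀ hk₀pos Real.pi_pos]
    calc |κ| * Real.pi = |κ| * β * (Real.pi / β) := by field_simp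
      _ ≤ |κ| * β * |fermiMatsubara β m| := by gcongr
  have hA : 1 + |κ| / |fermiMatsubara β m| ≤ 1 + |κ| * β / Real.pi := by linarith
  have hA0 : 0 ≤ 1 + |κ| / |fermiMatsubara β m| := by positivity
  gcongr

end Summit.HubbardSuperconductivity.HubbardSuperconductivity.Theorems.ThermalGreen

end
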